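import Literature.Geometry.Symplectic.SymplecticSplittingIso
import Literature.AlgebraicTopology.CharacteristicClasses.FibrewiseContinuity
import HarnessLib

/-!
# The symplectic normal line bundle realised inside the tangent bundle

McDuff–Salamon, *Introduction to Symplectic Topology* (3rd ed. 2017), §3.4 p. 114: for a
symplectic submanifold `Q ⊂ (M, ω)` "the normal bundle `ν_Q` may be identified with the
complementary symplectic bundle `TQ^ω`". The tree's symplectic normal LINE bundle
`SymplecticSplitting.normalCore` / `symplecticNormalBundle` of a symplectic surface `b : S → (N, s)`
(`SymplecticSplittingIso.lean`) is an abstract `VectorBundleCore ℂ S ℂ S` whose fibre over `y` is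
the coordinate line `ℂ` of the frame `ñ(y; y) = n_y` (the seed vector of `y`) in the symplectic
normal plane `G_y = (b_* T_y S)^s ⊆ T_{b y} N` with its adapted complex structure `J̃_y`
(`SymplecticSplitting.adaptedJ`). This file realises it inside `TN`:

* `SymplecticSplitting.cmul J' z v = (re z) v + (im z) J' v` — the complex scalar action defined by
  a complex structure `J'`, and `lineVec a d J n z = cmul J̃ z n`, the inverse of the line coordinate
  `κ_n = lineCoord a d J n` on `G` (`lineCoord_lineVec`, `lineVec_lineCoord`);
* `SymplecticSplitting.normalVector … y v ∈ T_{b y} N` — the vector `v · n_y` of `G_y` named by the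
  fibre element `v ∈ ν_y = ℂ`; it is `ℝ`-linear and injective in `v` with image `G_y`
  (`normalVector_mem_normalSpace`, `normalVector_eq_zero_iff`, `exists_normalVector_eq`), and in the
  trivialisation of `ν` at `y₀` it reads `v ↦ z · ñ(y₀; y)` (`normalVector_coordChange`: the cocycle
  `lineCoord_mul` and the frame expansion `lineCoord_expand`);
* `SymplecticSplitting.normalMap … : E(ν) → TN`, `v ↦ (b y, normalVector y v)` — **a continuous
  injective fibrewise-linear bundle map over `b` realising `ν` as the subbundle `G ⊆ b^* TN`**
  (`continuous_normalMap`, by the tree's chart criterion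
  `CharacteristicClasses.continuous_totalSpace_map`: in the charts at `y₀` and `b y₀` the map is
  `(y, z) ↦ z · (chart frame)`, continuous by Parts 2–3 of `SymplecticSplittingIso.lean`);
* `SymplecticSplitting.normSq … : E(ν) → ℝ`, `v ↦ s(v · n_y, J̃_y (v · n_y)) = |v|² s(n_y, J̃ n_y)` —
  a continuous fibrewise quadratic "norm" on `E(ν)`, positive off the zero section and homogeneous
  (`continuous_normSq`, `normSq_pos`, `normSq_smul`), used to cut round tubes.

This is the first brick of the tubular neighbourhood of a symplectic surface (the exponential map
of a metric composed with `normalMap`), towards the self-intersection formula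
`⟨c₁(ν_S), [S]⟩ = S·S` (McDuff–Salamon 2017, Ex. 4.4.5 with Thm. 2.7.5). Everything is proved; the
definitions have bodies; no named facts.

## References

* [McDuffSalamon2017] D. McDuff, D. Salamon, Introduction to Symplectic Topology, 3rd ed., OUP
  2017, §3.4 p. 114; §2.6; Ex. 4.4.5.
* [HusemollerFibreBundles1994] D. Husemoller, Fibre Bundles, 3rd ed. (1994), Ch. 3 §2, Ch. 5 §2
  (morphisms of bundles are checked on charts).
-/

noncomputable section

open scoped Manifold ContDiff Topology RealInnerProductSpace
open Function Module Set Bundle Complex Literature.Geometry.Kaehler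

namespace Literature.Geometry.Symplectic

namespace SymplecticSplitting

/-! ### The complex scalar action of a complex structure and the frame vector `z · n` -/

section Cmul

variable {V : Type*} [NormedAddCommGroup V] [NormedSpace ℝ V]

/-- **The complex scalar action defined by a complex structure `J'`**: `z · v = (re z) v + (im z) J' v`.
[cite: McDuffSalamon2017, §2.6] -/
def cmul (J' : V →L[ℝ] V) (z : ℂ) (v : V) : V := z.re • v + z.im • J' v

/-- Unfolding `cmul`. [folklore] -/
theorem cmul_apply (J' : V →L[ℝ] V) (z : ℂ) (v : V) : cmul J' z v = z.re • v + z.im • J' v := rfl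

/-- `1 · v = v`. [folklore] -/
@[simp]
theorem cmul_one (J' : V →L[ℝ] V) (v : V) : cmul J' 1 v = v := by
  simp [cmul]

/-- `0 · v = 0`. [folklore] -/
@[simp]
theorem cmul_zero_left (J' : V →L[ℝ] V) (v : V) : cmul J' 0 v = 0 := by
  simp [cmul]

/-- `z · 0 = 0`. [folklore] -/
@[simp]
theorem cmul_zero_right (J' : V →L[ℝ] V) (z : ℂ) : cmul J' z (0 : V) = 0 := by
  simp [cmul]

/-- A real scalar acts by real scalar multiplication. [folklore] -/
theorem cmul_ofReal (J' : V →L[ℝ] V) (c : ℝ) (v : V) : cmul J' (c : ℂ) v = c • v := by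
  simp [cmul]

/-- `i · v = J' v`. [folklore] -/
theorem cmul_I (J' : V →L[ℝ] V) (v : V) : cmul J' Complex.I v = J' v := by
  simp [cmul]

/-- Additivity in the scalar. [folklore] -/
theorem cmul_add_left (J' : V →L[ℝ] V) (z z' : ℂ) (v : V) :
    cmul J' (z + z') v = cmul J' z v + cmul J' z' v := by
  simp only [cmul, Complex.add_re, Complex.add_im, add_smul]
  abel

/-- Additivity in the vector. [folklore] -/
theorem cmul_add_right (J' : V →L[ℝ] V) (z : ℂ) (v w : V) :
    cmul J' z (v + w) = cmul J' z v + cmul J' z w := by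
  simp only [cmul, map_add, smul_add]
  abel

/-- Real homogeneity in the scalar. [folklore] -/
theorem cmul_real_smul_left (J' : V →L[ℝ] V) (c : ℝ) (z : ℂ) (v : V) :
    cmul J' ((c : ℂ) * z) v = c • cmul J' z v := by
  simp only [cmul, Complex.re_ofReal_mul, Complex.im_ofReal_mul, mul_smul, smul_add]

/-- Real homogeneity in the vector. [folklore] -/
theorem cmul_smul_right (J' : V →L[ℝ] V) (z : ℂ) (c : ℝ) (v : V) :
    cmul J' z (c • v) = c • cmul J' z v := by
  simp only [cmul, map_smul, smul_add, smul_comm c]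

/-- **Multiplicativity**: `(z z') · v = z · (z' · v)` when `J'² = -1`. [folklore] -/
theorem cmul_mul (J' : V →L[ℝ] V) (hJ : ∀ v, J' (J' v) = -v) (z z' : ℂ) (v : V) :
    cmul J' (z * z') v = cmul J' z (cmul J' z' v) := by
  simp only [cmul, Complex.mul_re, Complex.mul_im, map_add, map_smul, hJ, smul_add, smul_neg,
    sub_smul, add_smul, mul_smul]
  abel

/-- `z · (J' v) = J' (z · v)`. [folklore] -/
theorem cmul_J (J' : V →L[ℝ] V) (hJ : ∀ v, J' (J' v) = -v) (z : ℂ) (v : V) :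
    cmul J' z (J' v) = J' (cmul J' z v) := by
  simp only [cmul, map_add, map_smul, hJ]

/-- `(i z) · v = J' (z · v)`. [folklore] -/
theorem cmul_I_mul (J' : V →L[ℝ] V) (hJ : ∀ v, J' (J' v) = -v) (z : ℂ) (v : V) :
    cmul J' (Complex.I * z) v = J' (cmul J' z v) := by
  rw [cmul_mul J' hJ, cmul_I]

/-- `z ↦ z · v` is continuous (jointly in `(z, v)` for fixed `J'`). [folklore] -/
theorem continuous_cmul (J' : V →L[ℝ] V) : Continuous fun p : ℂ × V ↦ cmul J' p.1 p.2 := by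
  unfold cmul
  fun_prop

end Cmul

section LinearAlgebra

variable {V : Type*} [NormedAddCommGroup V] [InnerProductSpace ℝ V] [FiniteDimensional ℝ V]
  [CompleteSpace V] {W : Type*} [NormedAddCommGroup W] [InnerProductSpace ℝ W] [FiniteDimensional ℝ W]
  [CompleteSpace W] (a : V [⋀^Fin 2]→L[ℝ] ℝ) (d : W →L[ℝ] V) (J : V →L[ℝ] V)

/-- **The frame vector `z · n = (re z) n + (im z) J̃ n`** of the complex line `(G, J̃)` spanned by
`n`: the inverse of the line coordinate `κ_n` (McDuff–Salamon 2017, §2.6, unitary trivialisations).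
[cite: McDuffSalamon2017, §2.6] -/
def lineVec (n : V) (z : ℂ) : V := cmul (adaptedJ a d J) z n

omit [FiniteDimensional ℝ W] in
/-- Unfolding `lineVec`. [folklore] -/
theorem lineVec_apply (n : V) (z : ℂ) : lineVec a d J n z = z.re • n + z.im • adaptedJ a d J n := rfl

omit [FiniteDimensional ℝ W] in
/-- `lineVec n 1 = n`. [folklore] -/
@[simp]
theorem lineVec_one (n : V) : lineVec a d J n 1 = n := cmul_one _ n

omit [FiniteDimensional ℝ W] in
/-- `lineVec n 0 = 0`. [folklore] -/
@[simp]
theorem lineVec_zero (n : V) : lineVec a d J n 0 = 0 := cmul_zero_left _ n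

omit [FiniteDimensional ℝ W] in
/-- Additivity in `z`. [folklore] -/
theorem lineVec_add (n : V) (z z' : ℂ) : lineVec a d J n (z + z') = lineVec a d J n z + lineVec a d J n z' :=
  cmul_add_left _ z z' n

omit [FiniteDimensional ℝ W] in
/-- Real homogeneity in `z`. [folklore] -/
theorem lineVec_real_smul (n : V) (c : ℝ) (z : ℂ) : lineVec a d J n ((c : ℂ) * z) = c • lineVec a d J n z :=
  cmul_real_smul_left _ c z n

omit [FiniteDimensional ℝ V] [CompleteSpace V] in
/-- **Naturality of the action under conjugation**: `T (z ·_{J'} v) = z ·_{T J' T⁻¹} (T v)`. [folklore] -/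
theorem map_cmul (J' : V →L[ℝ] V) (T : V ≃L[ℝ] V) (z : ℂ) (v : V) :
    T (cmul J' z v) = cmul (conjV J' T) z (T v) := by
  simp only [cmul, map_add, map_smul, conjV_apply, ContinuousLinearEquiv.symm_apply_apply]

variable {a d J}
  (ha : ∀ v : V, v ≠ 0 → ∃ w : V, a ![v, w] ≠ 0)
  (hnd : ∀ u : W, u ≠ 0 → ∃ u' : W, a ![d u, d u'] ≠ 0)
  (hJt : ∀ v : V, v ≠ 0 → 0 < a ![v, J v])

omit [FiniteDimensional ℝ W] in
include ha hJt in
/-- `(z z') · n = z · (z' · n)`. [folklore] -/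
theorem lineVec_mul (n : V) (z z' : ℂ) : lineVec a d J n (z * z') = cmul (adaptedJ a d J) z (lineVec a d J n z') :=
  cmul_mul _ (adaptedJ_adaptedJ ha hJt) z z' n

include ha hnd hJt in
/-- **`κ_n (z · n) = z`** (`lineCoord_lincomb`). [cite: McDuffSalamon2017, §2.6] -/
theorem lineCoord_lineVec {n : V} (hn : n ∈ normalSpace a d) (hn0 : n ≠ 0) (z : ℂ) :
    lineCoord a d J n (lineVec a d J n z) = z := by
  rw [lineVec_apply, lineCoord_lincomb ha hnd hJt hn hn0]

include ha hnd hJt in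
/-- **`(κ_n v) · n = π_G v`** (`lineCoord_expand`): on `G` the frame vector inverts the coordinate.
[cite: McDuffSalamon2017, §2.6] -/
theorem lineVec_lineCoord (hdim : finrank ℝ V = finrank ℝ W + 2) {n : V} (hn : n ∈ normalSpace a d)
    (hn0 : n ≠ 0) (v : V) : lineVec a d J n (lineCoord a d J n v) = projG a d v := by
  rw [lineVec_apply, lineCoord_re, lineCoord_im, lineCoord_expand ha hnd hJt hdim hn hn0]

include ha hnd hJt in
/-- `z · n ∈ G` for `n ∈ G`. [folklore] -/
theorem lineVec_mem_normalSpace {n : V} (hn : n ∈ normalSpace a d) (z : ℂ) : lineVec a d J n z ∈ normalSpace a d :=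
  Submodule.add_mem _ (Submodule.smul_mem _ _ hn) (Submodule.smul_mem _ _ (adaptedJ_mem_normalSpace ha hnd hJt hn))

omit [FiniteDimensional ℝ W] in
include ha hJt in
/-- `z · n = 0 ↔ z = 0` for `n ≠ 0` (`n`, `J̃ n` are linearly independent). [folklore] -/
theorem lineVec_eq_zero_iff {n : V} (hn0 : n ≠ 0) (z : ℂ) : lineVec a d J n z = 0 ↔ z = 0 := by
  constructor
  · intro h
    have hli := linearIndependent_pair (d := d) ha hJt hn0
    rw [lineVec_apply] at h
    have h2 := (LinearIndependent.pair_iff.1 hli) z.re z.im (by simpa using h)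
    exact Complex.ext h2.1 h2.2
  · rintro rfl
    exact lineVec_zero a d J n

include ha hnd hJt in
/-- Every vector of `G` is `z · n` (`exists_eq_lincomb`). [cite: McDuffSalamon2017, Lemma 2.1.1] -/
theorem exists_lineVec_eq (hdim : finrank ℝ V = finrank ℝ W + 2) {n : V} (hn : n ∈ normalSpace a d)
    (hn0 : n ≠ 0) {v : V} (hv : v ∈ normalSpace a d) : ∃ z : ℂ, lineVec a d J n z = v :=
  ⟨lineCoord a d J n v, by rw [lineVec_lineCoord ha hnd hJt hdim hn hn0, projG_eq_self_of_mem hv]⟩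

include ha hnd hJt in
/-- **Change of frame**: `z · n = (κ_{n'}(n) z) · n'` for two nonzero vectors of `G`
(`dim V = dim W + 2`). [folklore] -/
theorem lineVec_eq_lineVec_mul (hdim : finrank ℝ V = finrank ℝ W + 2) {n n' : V}
    (hn : n ∈ normalSpace a d) (hn' : n' ∈ normalSpace a d) (hn'0 : n' ≠ 0) (z : ℂ) :
    lineVec a d J n z = lineVec a d J n' (z * lineCoord a d J n' n) := by
  rw [lineVec_mul ha hJt, lineVec_lineCoord ha hnd hJt hdim hn' hn'0, projG_eq_self_of_mem hn]
  rfl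

include ha hnd hJt in
/-- **Naturality**: `T (z · n) = z ·' (T n)` for the transported data (`adaptedJ_transport`). [folklore] -/
theorem lineVec_transport (T : V ≃L[ℝ] V) (τ : W ≃L[ℝ] W) (n : V) (z : ℂ) :
    T (lineVec a d J n z) = lineVec (formT a T) (injT d T τ) (conjV J T) (T n) z := by
  rw [lineVec_apply, lineVec_apply, map_add, map_smul, map_smul, adaptedJ_transport T τ hnd ha hJt,
    T.symm_apply_apply]

omit [FiniteDimensional ℝ W] in
/-- **The form on the frame vectors**: `a(z · n, J̃ (z · n)) = |z|² a(n, J̃ n)` — on the complex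
line `G = span(n, J̃ n)` the form is `a(n, J̃ n)` times the standard area form. [folklore] -/
theorem form_lineVec_adaptedJ (hJJ : ∀ v, adaptedJ a d J (adaptedJ a d J v) = -v) (n : V) (z : ℂ) :
    a ![lineVec a d J n z, adaptedJ a d J (lineVec a d J n z)] = Complex.normSq z * a ![n, adaptedJ a d J n] := by
  have h1 : a ![adaptedJ a d J n, n] = -a ![n, adaptedJ a d J n] := form_swap a _ _
  have h2 : a ![adaptedJ a d J n, adaptedJ a d J n] = 0 := form_self a _
  have h3 : a ![n, n] = 0 := form_self a _
  rw [lineVec_apply, map_add, map_smul, map_smul, hJJ, Complex.normSq_apply]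
  simp only [form_add_left, form_add_right, form_smul_left, form_smul_right, form_neg_right, h1, h2, h3]
  ring

/-! ### `(w, z) ↦ d w + (re z) m₁ + (im z) m₂` is an isomorphism for a frame `(m₁, m₂)` of `G` -/

omit [FiniteDimensional ℝ V] [CompleteSpace V] [FiniteDimensional ℝ W] [CompleteSpace W] in
/-- **The sum map of the splitting `V = d(W) ⊕ G` in a frame**: `(w, z) ↦ d w + (re z) m₁ + (im z) m₂`.
[cite: McDuffSalamon2017, §2.1 Lemma 2.1.1] -/
def frameSum (d : W →L[ℝ] V) (m₁ m₂ : V) : W × ℂ →L[ℝ] V :=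
  d.comp (ContinuousLinearMap.fst ℝ W ℂ) +
    ((Complex.reCLM.smulRight m₁ + Complex.imCLM.smulRight m₂).comp (ContinuousLinearMap.snd ℝ W ℂ))

omit [FiniteDimensional ℝ V] [CompleteSpace V] [FiniteDimensional ℝ W] [CompleteSpace W] in
/-- Unfolding `frameSum`. [folklore] -/
@[simp]
theorem frameSum_apply (d : W →L[ℝ] V) (m₁ m₂ : V) (p : W × ℂ) :
    frameSum d m₁ m₂ p = d p.1 + (p.2.re • m₁ + p.2.im • m₂) := by
  simp [frameSum]

include hnd in
/-- **`(w, z) ↦ d w + (re z) m₁ + (im z) m₂` is bijective** when `m₁, m₂ ∈ G = (d W)^a` are linearly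
independent and `dim V = dim W + 2`: the symplectic left inverse `L` (`L d = 1`, `L|_G = 0`)
separates the summands, and the dimensions match (McDuff–Salamon 2017, Lemma 2.1.1:
`V = d(W) ⊕ d(W)^ω`). [cite: McDuffSalamon2017, §2.1 Lemma 2.1.1] -/
theorem frameSum_bijective (hdim : finrank ℝ V = finrank ℝ W + 2) {m₁ m₂ : V}
    (hm₁ : m₁ ∈ normalSpace a d) (hm₂ : m₂ ∈ normalSpace a d) (hli : LinearIndependent ℝ ![m₁, m₂]) :
    Bijective (frameSum d m₁ m₂) := by
  have hinj : Injective (frameSum d m₁ m₂) := by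
    rw [← ContinuousLinearMap.coe_coe, ← LinearMap.ker_eq_bot (f := (frameSum d m₁ m₂ : W × ℂ →ₗ[ℝ] V)),
      LinearMap.ker_eq_bot']
    rintro ⟨w, z⟩ h
    rw [ContinuousLinearMap.coe_coe, frameSum_apply] at h
    -- apply the left inverse: `w = 0`
    have hL := congrArg (leftInv a d) h
    rw [map_add, leftInv_d hnd, map_zero, (mem_normalSpace_iff a d _).1
      (Submodule.add_mem _ (Submodule.smul_mem _ _ hm₁) (Submodule.smul_mem _ _ hm₂)), add_zero] at hL
    subst hL
    rw [map_zero, zero_add] at h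
    have h2 := (LinearIndependent.pair_iff.1 hli) z.re z.im (by simpa using h)
    have hz : z = 0 := Complex.ext h2.1 h2.2
    subst hz
    rfl
  refine ⟨hinj, ?_⟩
  have hfin : finrank ℝ (W × ℂ) = finrank ℝ V := by
    rw [Module.finrank_prod, Complex.finrank_real_complex, hdim]
  exact (LinearMap.injective_iff_surjective_of_finrank_eq_finrank hfin
    (f := (frameSum d m₁ m₂ : W × ℂ →ₗ[ℝ] V))).1 hinj

include hnd in
/-- The sum map as a continuous linear isomorphism `W × ℂ ≃ V`. [cite: McDuffSalamon2017, §2.1 Lemma 2.1.1] -/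
def frameSumEquiv (hdim : finrank ℝ V = finrank ℝ W + 2) {m₁ m₂ : V}
    (hm₁ : m₁ ∈ normalSpace a d) (hm₂ : m₂ ∈ normalSpace a d) (hli : LinearIndependent ℝ ![m₁, m₂]) :
    (W × ℂ) ≃L[ℝ] V :=
  ContinuousLinearEquiv.ofBijective (frameSum d m₁ m₂)
    (LinearMap.ker_eq_bot.2 (frameSum_bijective hnd hdim hm₁ hm₂ hli).1)
    (LinearMap.range_eq_top.2 (frameSum_bijective hnd hdim hm₁ hm₂ hli).2)

include hnd in
/-- The isomorphism is the sum map. [folklore] -/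
@[simp]
theorem coe_frameSumEquiv (hdim : finrank ℝ V = finrank ℝ W + 2) {m₁ m₂ : V}
    (hm₁ : m₁ ∈ normalSpace a d) (hm₂ : m₂ ∈ normalSpace a d) (hli : LinearIndependent ℝ ![m₁, m₂]) :
    (frameSumEquiv hnd hdim hm₁ hm₂ hli : (W × ℂ) →L[ℝ] V) = frameSum d m₁ m₂ := rfl

omit [FiniteDimensional ℝ W] in
/-- In the seed frame the sum map is `(w, z) ↦ d w + z · n`. [folklore] -/
theorem frameSum_seed_apply (n : V) (p : W × ℂ) :
    frameSum d n (adaptedJ a d J n) p = d p.1 + lineVec a d J n p.2 := by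
  rw [frameSum_apply, lineVec_apply]

end LinearAlgebra

/-! ### Continuity of the frame vector in the chart data -/

section ChartContinuity

variable {V : Type*} [NormedAddCommGroup V] [InnerProductSpace ℝ V] [FiniteDimensional ℝ V]
  [CompleteSpace V] {W : Type*} [NormedAddCommGroup W] [InnerProductSpace ℝ W] [FiniteDimensional ℝ W]
  [CompleteSpace W] {X : Type*} [TopologicalSpace X] {U : Set X}
  {a : X → V [⋀^Fin 2]→L[ℝ] ℝ} {d : X → W →L[ℝ] V} {J : X → V →L[ℝ] V} {n : X → V}

/-- **`(x, z) ↦ z · n(x)` is continuous** on `U × ℂ` when the data `a, d, J` and the frame `n` are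
continuous on `U` (continuity of the adapted `J̃`, `continuousOn_adaptedJ`). [folklore] -/
theorem continuousOn_lineVec (ha : ContinuousOn a U) (hd : ContinuousOn d U) (hJ : ContinuousOn J U)
    (hn : ContinuousOn n U)
    (hau : ∀ x ∈ U, ∀ v : V, v ≠ 0 → ∃ w : V, a x ![v, w] ≠ 0)
    (hnd : ∀ x ∈ U, ∀ u : W, u ≠ 0 → ∃ u' : W, a x ![d x u, d x u'] ≠ 0)
    (hJt : ∀ x ∈ U, ∀ v : V, v ≠ 0 → 0 < a x ![v, J x v]) :
    ContinuousOn (fun q : X × ℂ ↦ lineVec (a q.1) (d q.1) (J q.1) (n q.1) q.2) (U ×ˢ univ) := by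
  have hJn : ContinuousOn (fun x ↦ adaptedJ (a x) (d x) (J x) (n x)) U :=
    (continuousOn_adaptedJ ha hd hJ hau hnd hJt).clm_apply hn
  have h1 : ContinuousOn (fun q : X × ℂ ↦ n q.1) (U ×ˢ univ) :=
    hn.comp continuousOn_fst fun q hq ↦ hq.1
  have h2 : ContinuousOn (fun q : X × ℂ ↦ adaptedJ (a q.1) (d q.1) (J q.1) (n q.1)) (U ×ˢ univ) :=
    hJn.comp continuousOn_fst fun q hq ↦ hq.1
  have hre : Continuous fun q : X × ℂ ↦ q.2.re := Complex.continuous_re.comp continuous_snd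
  have him : Continuous fun q : X × ℂ ↦ q.2.im := Complex.continuous_im.comp continuous_snd
  simp only [lineVec_apply]
  exact (hre.continuousOn.smul h1).add (him.continuousOn.smul h2)

end ChartContinuity

/-! ### The normal vector named by a fibre element, and its chart expression -/

section Bundle

variable {EN : Type*} [NormedAddCommGroup EN] [InnerProductSpace ℝ EN] [FiniteDimensional ℝ EN]
  [CompleteSpace EN] {HN : Type*} [TopologicalSpace HN] {IN : ModelWithCorners ℝ EN HN}
  {N : Type*} [TopologicalSpace N] [ChartedSpace HN N]
  {ES : Type*} [NormedAddCommGroup ES] [InnerProductSpace ℝ ES] [FiniteDimensional ℝ ES]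
  [CompleteSpace ES] {HS : Type*} [TopologicalSpace HS] {IS : ModelWithCorners ℝ ES HS}
  {S : Type*} [TopologicalSpace S] [ChartedSpace HS S]
  [IsManifold IN ∞ N] [IsManifold IS ∞ S] {s : MForm IN N ℝ 2} (J : AlmostComplexStructure IN ∞ N)
  {b : S → N}

/-- **The normal vector named by a fibre element**: for `v ∈ ν_y = ℂ` (the coordinate in the frame of
the seed `n_y` of `y`), the vector `v · n_y = (re v) n_y + (im v) J̃_y n_y ∈ G_y ⊆ T_{b y} N`
(McDuff–Salamon 2017, §3.4 p. 114: `ν_Q ≅ TQ^ω`). [cite: McDuffSalamon2017, §3.4 p. 114] -/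
def normalVector (hbnd : ∀ y, PullbackNondegAt IS s b y) (hdim : finrank ℝ EN = finrank ℝ ES + 2)
    (y : S) (v : ℂ) : EN :=
  lineVec (formAt s (b y)) (rawDeriv IN IS b y) (J.Jm (b y)) (seed hbnd hdim y) v

variable {J} (hs : IsSmoothForm s)
  (hsnd : ∀ (x : N) (v : TangentSpace IN x), v ≠ 0 → ∃ w : TangentSpace IN x, s x ![v, w] ≠ 0)
  (hJt : J.IsTamedBy s) (hb : ContMDiff IS IN ∞ b) (hbnd : ∀ y, PullbackNondegAt IS s b y)
  (hdim : finrank ℝ EN = finrank ℝ ES + 2)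

omit [IsManifold IS ∞ S] in
/-- Unfolding `normalVector`. [folklore] -/
theorem normalVector_apply (y : S) (v : ℂ) :
    normalVector J hbnd hdim y v =
      v.re • seed hbnd hdim y + v.im • adaptedJ (formAt s (b y)) (rawDeriv IN IS b y) (J.Jm (b y)) (seed hbnd hdim y) :=
  rfl

omit [IsManifold IS ∞ S] in
/-- `0 · n_y = 0`. [folklore] -/
@[simp]
theorem normalVector_zero (y : S) : normalVector J hbnd hdim y 0 = 0 := lineVec_zero _ _ _ _

omit [IsManifold IS ∞ S] in
/-- `1 · n_y = n_y`: the unit of the fibre names the seed. [folklore] -/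
@[simp]
theorem normalVector_one (y : S) : normalVector J hbnd hdim y 1 = seed hbnd hdim y := lineVec_one _ _ _ _

omit [IsManifold IS ∞ S] in
/-- Additivity in the fibre element. [folklore] -/
theorem normalVector_add (y : S) (v w : ℂ) :
    normalVector J hbnd hdim y (v + w) = normalVector J hbnd hdim y v + normalVector J hbnd hdim y w :=
  lineVec_add _ _ _ _ v w

omit [IsManifold IS ∞ S] in
/-- Real homogeneity in the fibre element. [folklore] -/
theorem normalVector_real_smul (y : S) (c : ℝ) (v : ℂ) :
    normalVector J hbnd hdim y ((c : ℂ) * v) = c • normalVector J hbnd hdim y v :=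
  lineVec_real_smul _ _ _ _ c v

omit [IsManifold IS ∞ S] in
include hsnd hJt in
/-- **The normal vector lies in the symplectic normal plane `G_y`.** [cite: McDuffSalamon2017, §3.4 p. 114] -/
theorem normalVector_mem_normalSpace (y : S) (v : ℂ) :
    normalVector J hbnd hdim y v ∈ normalSpace (formAt s (b y)) (rawDeriv IN IS b y) :=
  lineVec_mem_normalSpace (nondeg_formAt hsnd (b y)) (hbnd y) (tame_Jm hJt (b y)) (seed_mem hbnd hdim y) v

omit [IsManifold IS ∞ S] in
include hsnd hJt in
/-- **The normal vector vanishes only for the zero fibre element** (injectivity on fibres). [folklore] -/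
theorem normalVector_eq_zero_iff (y : S) (v : ℂ) : normalVector J hbnd hdim y v = 0 ↔ v = 0 :=
  lineVec_eq_zero_iff (d := rawDeriv IN IS b y) (nondeg_formAt hsnd (b y)) (tame_Jm hJt (b y))
    (seed_ne_zero hbnd hdim y) v

omit [IsManifold IS ∞ S] in
include hsnd hJt in
/-- **`v ↦ v · n_y` is injective.** [folklore] -/
theorem normalVector_injective (y : S) : Injective (normalVector J hbnd hdim y) := by
  intro v v' h
  have h0 : normalVector J hbnd hdim y (v - v') = 0 := by
    have hadd := normalVector_add (J := J) hbnd hdim y (v - v') v'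
    rw [sub_add_cancel, h] at hadd
    exact add_eq_right.1 hadd.symm
  exact sub_eq_zero.1 ((normalVector_eq_zero_iff hsnd hJt hbnd hdim y _).1 h0)

omit [IsManifold IS ∞ S] in
include hsnd hJt in
/-- **Every vector of `G_y` is a normal vector** (surjectivity onto the fibre `G_y`). [cite: McDuffSalamon2017, Lemma 2.1.1] -/
theorem exists_normalVector_eq (y : S) {w : EN} (hw : w ∈ normalSpace (formAt s (b y)) (rawDeriv IN IS b y)) :
    ∃ v : ℂ, normalVector J hbnd hdim y v = w :=
  exists_lineVec_eq (nondeg_formAt hsnd (b y)) (hbnd y) (tame_Jm hJt (b y)) hdim (seed_mem hbnd hdim y)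
    (seed_ne_zero hbnd hdim y) hw

/-- The base set of the chart of `ν` at `y₀` lies in the chart domain of `y₀`. [folklore] -/
theorem mem_chartDomain_of_mem_baseSet {y₀ y : S} (hy : y ∈ (normalCore hs hsnd hJt hb hbnd hdim).baseSet y₀) :
    y ∈ chartDomain IN IS b y₀ := by
  have hy' := hy
  rw [normalCore_baseSet] at hy'
  exact hy'.1

include hsnd hJt in
/-- **The normal vector in the trivialisation at `y₀`**: the fibre element with coordinate `z` in
the chart of `ν` indexed by `y₀` names the vector `z · ñ(y₀; y)` of the frame of `y₀` (the
transition functions of `normalCore` are the line coordinates `κ_{n_y}(ñ(y₀; y))`, and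
`(z κ_{n'}(n)) · n' = z · n`). [cite: McDuffSalamon2017, §2.6] -/
theorem normalVector_coordChange (y₀ y : S) (z : ℂ) :
    normalVector J hbnd hdim y ((normalCore hs hsnd hJt hb hbnd hdim).coordChange y₀ y y z) =
      lineVec (formAt s (b y)) (rawDeriv IN IS b y) (J.Jm (b y)) (rawFrame IS s b (seed hbnd hdim y₀) y₀ y) z := by
  have hself : rawFrame IS s b (seed hbnd hdim y) y y = seed hbnd hdim y := by
    rw [rawFrame_self s b, projG_eq_self_of_mem (seed_mem hbnd hdim y)]
  rw [normalCore_coordChange, transitionCoeff, hself, normalVector, mul_comm]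
  exact (lineVec_eq_lineVec_mul (nondeg_formAt hsnd (b y)) (hbnd y) (tame_Jm hJt (b y)) hdim
    (rawFrame_mem s b hbnd _ y₀ y) (seed_mem hbnd hdim y) (seed_ne_zero hbnd hdim y) z).symm

/-! ### The realisation map `E(ν) → TN` and its continuity -/

/-- **The realisation of the symplectic normal bundle inside `TN`**: the bundle map over `b`,
`E(ν) → TN`, `v ↦ (b y, v · n_y)` (`y` the base point of `v`). [cite: McDuffSalamon2017, §3.4 p. 114] -/
def normalMap (v : (normalCore hs hsnd hJt hb hbnd hdim).TotalSpace) : TangentBundle IN N :=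
  TotalSpace.mk' EN (b v.proj) (normalVector J hbnd hdim v.proj v.2 :)

/-- The base point of the realised vector is `b y`. [folklore] -/
@[simp]
theorem normalMap_proj (v : (normalCore hs hsnd hJt hb hbnd hdim).TotalSpace) :
    (normalMap hs hsnd hJt hb hbnd hdim v).proj = b v.proj := rfl

/-- The fibre component of the realised vector is the normal vector. [folklore] -/
@[simp]
theorem normalMap_snd (v : (normalCore hs hsnd hJt hb hbnd hdim).TotalSpace) :
    (normalMap hs hsnd hJt hb hbnd hdim v).2 = normalVector J hbnd hdim v.proj v.2 := rfl

/-- **The zero section is realised by the zero section of `TN` along `b`.** [folklore] -/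
theorem normalMap_zeroSection (y : S) :
    normalMap hs hsnd hJt hb hbnd hdim (zeroSection ℂ (normalCore hs hsnd hJt hb hbnd hdim).Fiber y) =
      TotalSpace.mk' EN (b y) (0 : EN) :=
  congrArg (TotalSpace.mk' (F := EN) (E := (TangentSpace IN : N → Type _)) (b y))
    (normalVector_zero (J := J) hbnd hdim y)

/-- **The chart expression of the realisation map**: for `y` in the base set of `y₀` (inside the
chart domain of `y₀`), the tangent trivialisation at `b y₀` reads the normal vector of the fibre
element of chart coordinate `z` as `z · (chart frame of y₀ at y)`, the frame vector of the chart
data `(s, db, J)` read in the charts at `y₀`, `b y₀`. [folklore] -/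
theorem tangentEquiv_normalVector_coordChange {y₀ y : S}
    (hy : y ∈ (normalCore hs hsnd hJt hb hbnd hdim).baseSet y₀) (z : ℂ) :
    tangentEquiv (I := IN) (b y₀) (b y)
        (apply_mem_source_of_mem_chartDomain (mem_chartDomain_of_mem_baseSet hs hsnd hJt hb hbnd hdim hy))
        (normalVector J hbnd hdim y ((normalCore hs hsnd hJt hb hbnd hdim).coordChange y₀ y y z)) =
      lineVec (chartForm IN s b y₀ y) (chartDeriv IN IS b y₀ y) (J.coordJ (b y₀) (b y))
        (chartFrame IS s b (seed hbnd hdim y₀) y₀ y) z := by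
  have hy1 : y ∈ chartDomain IN IS b y₀ := mem_chartDomain_of_mem_baseSet hs hsnd hJt hb hbnd hdim hy
  rw [normalVector_coordChange hs hsnd hJt hb hbnd hdim y₀ y,
    lineVec_transport (nondeg_formAt hsnd (b y)) (hbnd y) (tame_Jm hJt (b y))
      (tangentEquiv (I := IN) (b y₀) (b y) (apply_mem_source_of_mem_chartDomain hy1))
      (tangentEquiv (I := IS) y₀ y (mem_source_of_mem_chartDomain hy1)),
    tangentEquiv_rawFrame s b hbnd _ hy1, ← chartForm_eq_formT s b hy1, ← chartDeriv_eq_injT b hy1,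
    ← coordJ_eq_conjV J (apply_mem_source_of_mem_chartDomain hy1)]

include hs hsnd hJt hb in
/-- **The chart expression is continuous on (chart domain of `y₀`) × `ℂ`.** [folklore] -/
theorem continuousOn_chartLineVec (y₀ : S) :
    ContinuousOn (fun q : S × ℂ ↦ lineVec (chartForm IN s b y₀ q.1) (chartDeriv IN IS b y₀ q.1)
      (J.coordJ (b y₀) (b q.1)) (chartFrame IS s b (seed hbnd hdim y₀) y₀ q.1) q.2)
      (chartDomain IN IS b y₀ ×ˢ univ) :=
  continuousOn_lineVec (a := chartForm IN s b y₀) (d := chartDeriv IN IS b y₀)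
    (J := fun y ↦ J.coordJ (b y₀) (b y)) (n := chartFrame IS s b (seed hbnd hdim y₀) y₀)
    (continuousOn_chartForm hs hb.continuous y₀)
    (continuousOn_chartDeriv (n := ∞) hb (by norm_num) y₀) (continuousOn_coordJ_comp J hb.continuous y₀)
    (continuousOn_chartFrame s b hs hb hbnd _ y₀) (chartForm_nondeg (nondeg_formAt hsnd) y₀)
    (chartForm_chartDeriv_nondeg hbnd y₀) (chartForm_coordJ_tame hJt y₀)

/-- **The realisation map `E(ν) → TN` is continuous** (Husemoller: a fibrewise map is continuous
when its expressions in the charts are; the tree's `CharacteristicClasses.continuous_totalSpace_map`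
with the chart expression `tangentEquiv_normalVector_coordChange`).
[cite: HusemollerFibreBundles1994, Ch. 3 §2] -/
theorem continuous_normalMap : Continuous (normalMap hs hsnd hJt hb hbnd hdim) := by
  set Z := normalCore hs hsnd hJt hb hbnd hdim with hZ
  refine Literature.AlgebraicTopology.CharacteristicClasses.continuous_totalSpace_map (F₁ := ℂ) (F₂ := EN)
    (E₁ := Z.Fiber) (E₂ := (TangentSpace IN : N → Type _)) hb.continuous
    (fun y v ↦ (normalVector J hbnd hdim y v :)) fun p ↦ ?_
  obtain ⟨y₀, w⟩ := p
  -- the point of the chart at `y₀`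
  have hpt : trivializationAt ℂ Z.Fiber y₀ ⟨y₀, w⟩ = ((y₀, w) : S × ℂ) := by
    change Z.localTrivAt y₀ ⟨y₀, w⟩ = ((y₀, w) : S × ℂ)
    rw [Z.localTrivAt_apply_mk]
  rw [hpt]
  -- near `(y₀, w)` the chart expression is the continuous `lineVec` of the chart data
  have hN : ∀ᶠ q : S × ℂ in 𝓝 (y₀, w), q.1 ∈ Z.baseSet y₀ :=
    (continuousAt_fst (p := (y₀, w))).preimage_mem_nhds ((Z.isOpen_baseSet y₀).mem_nhds (Z.mem_baseSet_at y₀))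
  have hcont : ContinuousAt (fun q : S × ℂ ↦ lineVec (chartForm IN s b y₀ q.1) (chartDeriv IN IS b y₀ q.1)
      (J.coordJ (b y₀) (b q.1)) (chartFrame IS s b (seed hbnd hdim y₀) y₀ q.1) q.2) (y₀, w) :=
    (continuousOn_chartLineVec hs hsnd hJt hb hbnd hdim y₀).continuousAt
      ((isOpen_chartDomain hb.continuous y₀).prod isOpen_univ |>.mem_nhds ⟨mem_chartDomain_self b y₀, mem_univ _⟩)
  refine hcont.congr_of_eventuallyEq ?_
  filter_upwards [hN] with q hq
  -- unfold the chart of `ν` at `y₀` and the tangent chart at `b y₀`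
  change (trivializationAt EN (TangentSpace IN : N → Type _) (b y₀)
      (TotalSpace.mk' EN (b q.1) (normalVector J hbnd hdim q.1 (Z.coordChange y₀ (Z.indexAt q.1) q.1 q.2) :))).2 = _
  rw [← tangentEquiv_normalVector_coordChange hs hsnd hJt hb hbnd hdim hq q.2]
  rfl


/-! ### The fibrewise quadratic norm `|v|² = s(v · n, J̃ (v · n))` -/

/-- **The fibrewise quadratic norm on `E(ν)`**: `|v|² := s(v · n_y, J̃_y (v · n_y))`, the
`s`-area of the normal vector against its `J̃`-rotate (the tame metric of `J̃` on `G_y`; positive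
for `v ≠ 0`, McDuff–Salamon 2017, Prop. 2.5.6 (2.5.10)). [cite: McDuffSalamon2017, Prop. 2.5.6] -/
def normSq (v : (normalCore hs hsnd hJt hb hbnd hdim).TotalSpace) : ℝ :=
  formAt s (b v.proj) ![normalVector J hbnd hdim v.proj v.2,
    adaptedJ (formAt s (b v.proj)) (rawDeriv IN IS b v.proj) (J.Jm (b v.proj)) (normalVector J hbnd hdim v.proj v.2)]

/-- **`|v|² = |z|² s(n_y, J̃ n_y)`** for the fibre element of coordinate `z` (in the seed frame of
`y`): on the complex line `G_y` the form is `s(n_y, J̃ n_y)` times the standard area form. [folklore] -/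
theorem normSq_mk (y : S) (z : ℂ) :
    normSq hs hsnd hJt hb hbnd hdim ⟨y, z⟩ =
      Complex.normSq z * formAt s (b y) ![seed hbnd hdim y,
        adaptedJ (formAt s (b y)) (rawDeriv IN IS b y) (J.Jm (b y)) (seed hbnd hdim y)] :=
  form_lineVec_adaptedJ (adaptedJ_adaptedJ (nondeg_formAt hsnd (b y)) (tame_Jm hJt (b y))) _ z

include hsnd hJt in
omit [IsManifold IS ∞ S] in
/-- `s(n_y, J̃ n_y) > 0`: the seed has positive area against its rotate (`J̃` is `s`-tame).
[cite: McDuffSalamon2017, Prop. 2.5.6 (2.5.10)] -/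
theorem seedArea_pos (y : S) :
    0 < formAt s (b y) ![seed hbnd hdim y,
      adaptedJ (formAt s (b y)) (rawDeriv IN IS b y) (J.Jm (b y)) (seed hbnd hdim y)] :=
  form_self_adaptedJ_pos (d := rawDeriv IN IS b y) (nondeg_formAt hsnd (b y)) (tame_Jm hJt (b y))
    (seed_ne_zero hbnd hdim y)

/-- **`|v|² ≥ 0`.** [folklore] -/
theorem normSq_nonneg (v : (normalCore hs hsnd hJt hb hbnd hdim).TotalSpace) :
    0 ≤ normSq hs hsnd hJt hb hbnd hdim v := by
  obtain ⟨y, z⟩ := v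
  rw [normSq_mk]
  exact mul_nonneg (Complex.normSq_nonneg _) (seedArea_pos hsnd hJt hbnd hdim y).le

/-- **`|v|² = 0 ↔ v = 0`** (as a fibre element). [folklore] -/
theorem normSq_eq_zero_iff (v : (normalCore hs hsnd hJt hb hbnd hdim).TotalSpace) :
    normSq hs hsnd hJt hb hbnd hdim v = 0 ↔ v.2 = 0 := by
  obtain ⟨y, z⟩ := v
  rw [normSq_mk, mul_eq_zero, or_iff_left (seedArea_pos hsnd hJt hbnd hdim y).ne', Complex.normSq_eq_zero]
  exact Iff.rfl

/-- **`|v|² > 0` off the zero section.** [folklore] -/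
theorem normSq_pos {v : (normalCore hs hsnd hJt hb hbnd hdim).TotalSpace} (hv : v.2 ≠ 0) :
    0 < normSq hs hsnd hJt hb hbnd hdim v :=
  lt_of_le_of_ne (normSq_nonneg hs hsnd hJt hb hbnd hdim v)
    fun h ↦ hv ((normSq_eq_zero_iff hs hsnd hJt hb hbnd hdim v).1 h.symm)

/-- **Real homogeneity**: `|c v|² = c² |v|²`. [folklore] -/
theorem normSq_real_smul (y : S) (c : ℝ) (z : ℂ) :
    normSq hs hsnd hJt hb hbnd hdim ⟨y, (c : ℂ) * z⟩ = c ^ 2 * normSq hs hsnd hJt hb hbnd hdim ⟨y, z⟩ := by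
  rw [normSq_mk, normSq_mk, Complex.normSq_mul, Complex.normSq_ofReal]
  ring

/-- **The chart expression of `|·|²`**: for `v` over the base set of `y₀`, with `z` its coordinate
in the chart of `ν` at `y₀`, `|v|² = |z|² · ⟪Ω (chart frame), J̃' (chart frame)⟫` — the area of the
chart frame, a function of the chart data at `y₀` read at the base point. [folklore] -/
theorem normSq_eq_chart {y₀ : S} {v : (normalCore hs hsnd hJt hb hbnd hdim).TotalSpace}
    (hv : v.proj ∈ (normalCore hs hsnd hJt hb hbnd hdim).baseSet y₀) :
    normSq hs hsnd hJt hb hbnd hdim v =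
      Complex.normSq (((normalCore hs hsnd hJt hb hbnd hdim).localTriv y₀ v).2) *
        ⟪formOp (chartForm IN s b y₀ v.proj) (chartFrame IS s b (seed hbnd hdim y₀) y₀ v.proj),
          adaptedJ (chartForm IN s b y₀ v.proj) (chartDeriv IN IS b y₀ v.proj) (J.coordJ (b y₀) (b v.proj))
            (chartFrame IS s b (seed hbnd hdim y₀) y₀ v.proj)⟫ := by
  have hy1 : v.proj ∈ chartDomain IN IS b y₀ := mem_chartDomain_of_mem_baseSet hs hsnd hJt hb hbnd hdim hv
  -- the coordinate `z` of `v` in the chart at `y₀`, and `v.2` back from `z`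
  have hwz : v.2 = (normalCore hs hsnd hJt hb hbnd hdim).coordChange y₀ v.proj v.proj
      ((normalCore hs hsnd hJt hb hbnd hdim).coordChange v.proj y₀ v.proj v.2) := by
    rw [(normalCore hs hsnd hJt hb hbnd hdim).coordChange_comp v.proj y₀ v.proj v.proj
        ⟨⟨(normalCore hs hsnd hJt hb hbnd hdim).mem_baseSet_at v.proj, hv⟩,
          (normalCore hs hsnd hJt hb hbnd hdim).mem_baseSet_at v.proj⟩,
      (normalCore hs hsnd hJt hb hbnd hdim).coordChange_self v.proj v.proj
        ((normalCore hs hsnd hJt hb hbnd hdim).mem_baseSet_at v.proj)]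
  have htriv : (((normalCore hs hsnd hJt hb hbnd hdim).localTriv y₀) v).2 =
      (normalCore hs hsnd hJt hb hbnd hdim).coordChange v.proj y₀ v.proj v.2 := rfl
  rw [htriv]
  change formAt s (b v.proj) ![normalVector J hbnd hdim v.proj v.2,
    adaptedJ (formAt s (b v.proj)) (rawDeriv IN IS b v.proj) (J.Jm (b v.proj)) (normalVector J hbnd hdim v.proj v.2)] = _
  have key : normalVector J hbnd hdim v.proj v.2 =
      lineVec (formAt s (b v.proj)) (rawDeriv IN IS b v.proj) (J.Jm (b v.proj))
        (rawFrame IS s b (seed hbnd hdim y₀) y₀ v.proj)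
        ((normalCore hs hsnd hJt hb hbnd hdim).coordChange v.proj y₀ v.proj v.2) := by
    conv_lhs => rw [hwz]
    exact normalVector_coordChange hs hsnd hJt hb hbnd hdim y₀ v.proj _
  rw [key, form_lineVec_adaptedJ (adaptedJ_adaptedJ (nondeg_formAt hsnd (b v.proj)) (tame_Jm hJt (b v.proj))),
    inner_formOp]
  congr 1
  -- transport the area of the raw frame to the chart at `b y₀`
  rw [chartForm_eq_formT s b hy1, chartDeriv_eq_injT b hy1, coordJ_eq_conjV J (apply_mem_source_of_mem_chartDomain hy1),
    ← tangentEquiv_rawFrame s b hbnd _ hy1,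
    adaptedJ_transport _ (tangentEquiv (I := IS) y₀ v.proj (mem_source_of_mem_chartDomain hy1)) (hbnd v.proj)
      (nondeg_formAt hsnd (b v.proj)) (tame_Jm hJt (b v.proj)),
    ContinuousLinearEquiv.symm_apply_apply, formT_apply_apply]

include hs hsnd hJt hb hbnd in
/-- The area of the chart frame is continuous on the chart domain. [folklore] -/
theorem continuousOn_chartFrameArea (y₀ : S) :
    ContinuousOn (fun y ↦ ⟪formOp (chartForm IN s b y₀ y) (chartFrame IS s b (seed hbnd hdim y₀) y₀ y),
      adaptedJ (chartForm IN s b y₀ y) (chartDeriv IN IS b y₀ y) (J.coordJ (b y₀) (b y))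
        (chartFrame IS s b (seed hbnd hdim y₀) y₀ y)⟫) (chartDomain IN IS b y₀) := by
  have ha := continuousOn_chartForm (IS := IS) hs hb.continuous y₀
  have hd := continuousOn_chartDeriv (IN := IN) (IS := IS) (n := ∞) hb (by norm_num) y₀
  have hJ := continuousOn_coordJ_comp (IS := IS) J hb.continuous y₀
  have hn := continuousOn_chartFrame s b hs hb hbnd (seed hbnd hdim y₀) y₀
  have h1 : ContinuousOn (fun y ↦ formOp (chartForm IN s b y₀ y) (chartFrame IS s b (seed hbnd hdim y₀) y₀ y))
      (chartDomain IN IS b y₀) :=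
    (continuous_formOp.comp_continuousOn ha).clm_apply hn
  have h2 : ContinuousOn (fun y ↦ adaptedJ (chartForm IN s b y₀ y) (chartDeriv IN IS b y₀ y)
      (J.coordJ (b y₀) (b y)) (chartFrame IS s b (seed hbnd hdim y₀) y₀ y)) (chartDomain IN IS b y₀) :=
    (continuousOn_adaptedJ (J := fun y ↦ J.coordJ (b y₀) (b y)) ha hd hJ (chartForm_nondeg (nondeg_formAt hsnd) y₀)
      (chartForm_chartDeriv_nondeg hbnd y₀) (chartForm_coordJ_tame hJt y₀)).clm_apply hn
  exact h1.inner h2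

/-- **`|·|²` is continuous on `E(ν)`** (on the source of each chart of `ν` it is the continuous
chart expression `normSq_eq_chart` of the chart coordinates). [folklore] -/
theorem continuous_normSq : Continuous (normSq hs hsnd hJt hb hbnd hdim) := by
  refine continuous_iff_continuousAt.2 fun v ↦ ?_
  -- the chart expression near `v`, in the chart of `ν` at `y₀ := v.proj`
  have hsrc : ((normalCore hs hsnd hJt hb hbnd hdim).localTriv v.proj).source ∈ 𝓝 v :=
    ((normalCore hs hsnd hJt hb hbnd hdim).localTriv v.proj).open_source.mem_nhds
      (((normalCore hs hsnd hJt hb hbnd hdim).mem_localTriv_source v.proj v).2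
        ((normalCore hs hsnd hJt hb hbnd hdim).mem_baseSet_at v.proj))
  have hev : normSq hs hsnd hJt hb hbnd hdim =ᶠ[𝓝 v] fun u ↦
      Complex.normSq (((normalCore hs hsnd hJt hb hbnd hdim).localTriv v.proj u).2) *
        ⟪formOp (chartForm IN s b v.proj u.proj) (chartFrame IS s b (seed hbnd hdim v.proj) v.proj u.proj),
          adaptedJ (chartForm IN s b v.proj u.proj) (chartDeriv IN IS b v.proj u.proj) (J.coordJ (b v.proj) (b u.proj))
            (chartFrame IS s b (seed hbnd hdim v.proj) v.proj u.proj)⟫ := by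
    filter_upwards [hsrc] with u hu
    exact normSq_eq_chart hs hsnd hJt hb hbnd hdim (((normalCore hs hsnd hJt hb hbnd hdim).mem_localTriv_source v.proj u).1 hu)
  refine ContinuousAt.congr_of_eventuallyEq ?_ hev
  have he : ContinuousAt ((normalCore hs hsnd hJt hb hbnd hdim).localTriv v.proj) v :=
    ((normalCore hs hsnd hJt hb hbnd hdim).localTriv v.proj).continuousOn.continuousAt hsrc
  have h1 : ContinuousAt (fun u : (normalCore hs hsnd hJt hb hbnd hdim).TotalSpace ↦
      Complex.normSq (((normalCore hs hsnd hJt hb hbnd hdim).localTriv v.proj u).2)) v :=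
    Complex.continuous_normSq.continuousAt.comp (continuousAt_snd.comp he)
  have h2 : ContinuousAt (fun u : (normalCore hs hsnd hJt hb hbnd hdim).TotalSpace ↦
      ⟪formOp (chartForm IN s b v.proj u.proj) (chartFrame IS s b (seed hbnd hdim v.proj) v.proj u.proj),
        adaptedJ (chartForm IN s b v.proj u.proj) (chartDeriv IN IS b v.proj u.proj) (J.coordJ (b v.proj) (b u.proj))
          (chartFrame IS s b (seed hbnd hdim v.proj) v.proj u.proj)⟫) v :=
    ((continuousOn_chartFrameArea hs hsnd hJt hb hbnd hdim v.proj).continuousAt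
      ((isOpen_chartDomain hb.continuous v.proj).mem_nhds (mem_chartDomain_self b v.proj))).comp
      (FiberBundle.continuous_proj ℂ (normalCore hs hsnd hJt hb hbnd hdim).Fiber).continuousAt
  exact h1.mul h2

/-- **Injectivity of the realisation map**: it is injective on each fibre and `b` separates the
fibres, so it is injective as soon as `b` is. [folklore] -/
theorem normalMap_injective (hbi : Injective b) : Injective (normalMap hs hsnd hJt hb hbnd hdim) := by
  intro p q h
  obtain ⟨y, v⟩ := p
  obtain ⟨y', v'⟩ := q
  have h1 : b y = b y' := congrArg TotalSpace.proj h
  obtain rfl : y = y' := hbi h1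
  have h2 : normalVector J hbnd hdim y v = normalVector J hbnd hdim y v' :=
    (TotalSpace.mk_inj (b := b y)).1 h
  rw [normalVector_injective hsnd hJt hbnd hdim y h2]

end Bundle

end SymplecticSplitting

end Literature.Geometry.Symplectic

end
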